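import Literature.RepresentationTheory.CompactGroups.WeylIntegrationRegular
import Literature.RepresentationTheory.CompactGroups.WeylIntegrationOrbitMap
import Mathlib.Analysis.Calculus.InverseFunctionTheorem.ContDiff
import Mathlib.MeasureTheory.Measure.Lebesgue.EqHaar
import Mathlib.MeasureTheory.Measure.Lebesgue.Complex

/-!
# Weyl's integral formula for `U(n)`, file 4: `Ad(U(n))` on `𝔲(n)` in flat coordinates preserves Lebesgue measure;
# the orbit map is injective on `{‖z‖ < r} × C`; off-diagonal products

statement-level skeleton of published theorems with citation tags; proofs where landed; nothing here is a claim
about the Yang–Mills mass gap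

Mega-formalization `lit-balaban` (HOME `run/shared/lean/pub/lit-balaban/`), unit `lit-balaban-p28` gen 15 (Phase-2 proof
seat, free-target protocol G.5-34(d)): FILE 4 of the discharge of the tree's named fact
`Literature.RepresentationTheory.CompactGroups.weylIntegralFormula_unitary` ([BtD] IV (1.11), `G = U(n)`).
* §1 OFF-DIAGONAL PRODUCTS: `Π_i Π_{j≠i} h i j = Π_{j≺k} h j k · h k j` (`prod_offDiag_eq_prod_OD`), whence the
  Vandermonde square `Π_{j≺k}(θ_j − θ_k)² = Π_i Π_{j≠i} |θ_i − θ_j|` is invariant under the Weyl group `S(n)`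
  ([BtD] IV (3.2): `W(U(n)) = S(n)` permuting the coordinates of `LT`).
* §2 `Ad(u)`, `u ∈ U(n)`, in the flat coordinates of file 1 (`AdCoord u`): a group action by linear maps with
  `|det| = 1` (the unit ball of the unitarily invariant operator norm is `Ad`-invariant), hence
  `MeasurePreserving (AdCoord u) volume volume` — the invariance of «the Euclidean measure dX» under `Ad(K)` used in
  [Hel] I Thm. 5.17; the orbit map of file 2 is `orbitMap (z, θ) = Ad(e^{X(z)})(0, θ)`, and the Weyl group acts on
  the slice `{(0, θ)}` through `Ad` of permutation matrices.
* §3 INJECTIVITY: for some `r > 0` the orbit map is injective on `{‖z‖ < r} × C` (`exists_injOn_orbitMap`): Helgason's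
  «only the injectivity on `K/M × 𝔞⁺` remains to be verified» — the `T`-coset of `e^{X(z)}` is read off by file 3's
  `conj_diagI_eq_diagI`, and `z` is then recovered by ONE application of the inverse function theorem at `(0, θ₀)`
  (file 2: `det D(orbitMap)(0, θ₀) = Π_{j≺k}(θ₀_j − θ₀_k)² ≠ 0`).

0 named facts, 0 sorry.

## References
* S. Helgason, *Groups and Geometric Analysis*, AMS Surveys 83 (2000), Ch. I §5 Thm. 5.17 and its proof, p. 195
  (held: `book:helgason2000-groups-geometric-analysis`, p0186). [Helgason2000]
* Th. Bröcker, T. tom Dieck, *Representations of Compact Lie Groups*, GTM 98 (1985), Ch. IV (1.8), (1.11), (3.2)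
  (held: `book:brockernd-representations-compact-lie-groups`, p0152–p0153, p0161). [BrockerTomDieck1985]
-/

noncomputable section

open Complex Matrix MeasureTheory Equiv NormedSpace
open scoped ComplexConjugate Matrix.Norms.L2Operator ENNReal

namespace Literature.RepresentationTheory.CompactGroups.WeylIntegration

open Literature.MathematicalPhysics.QuantumFieldTheory.Balaban1983to89 (unitaryLogChart mem_unitaryLogChart_lie)
open Literature.Analysis.Calculus.ExpDifferential (exp_mul_exp_neg_eq_one exp_neg_mul_exp_eq_one)
open Literature.LinearAlgebra.Matrix (monomial)

variable {n : Type*} [Fintype n] [DecidableEq n]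

/-! ## §1 Off-diagonal products and the Weyl-group invariance of the Vandermonde square -/

section OffDiag

variable {α : Type*} [CommMonoid α]

/-- **`Π_i Π_{j≠i} h i j = Π_{j≺k} (h j k · h k j)`**: an off-diagonal double product is the product over the
positions `j ≺ k` of the two entries `(j,k)` and `(k,j)`. [cite: BrockerTomDieck1985, IV (1.11) p0153] -/
theorem prod_offDiag_eq_prod_OD (h : n → n → α) :
    ∏ i, ∏ j ∈ Finset.univ.erase i, h i j = ∏ p : OD n, (h p.1.1 p.1.2 * h p.1.2 p.1.1) := by
  classical
  -- as a product over the finite set of off-diagonal pairs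
  have h1 : ∏ i, ∏ j ∈ Finset.univ.erase i, h i j =
      ∏ q ∈ (Finset.univ : Finset (n × n)).filter (fun q => q.1 ≠ q.2), h q.1 q.2 := by
    rw [Finset.prod_filter, Fintype.prod_prod_type]
    refine Finset.prod_congr rfl fun i _ => ?_
    rw [← Finset.filter_ne Finset.univ i, Finset.prod_filter]
  -- split the off-diagonal pairs into `≺` and `≻`
  set Dlt := (Finset.univ : Finset (n × n)).filter (fun q => enum n q.1 < enum n q.2) with hDlt
  set Dgt := (Finset.univ : Finset (n × n)).filter (fun q => enum n q.2 < enum n q.1) with hDgt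
  have hsplit : (Finset.univ : Finset (n × n)).filter (fun q => q.1 ≠ q.2) = Dlt ∪ Dgt := by
    ext q
    simp only [Finset.mem_filter, Finset.mem_univ, true_and, Finset.mem_union, hDlt, hDgt]
    constructor
    · intro hq
      rcases lt_trichotomy (enum n q.1) (enum n q.2) with hlt | heq | hgt
      · exact Or.inl hlt
      · exact absurd ((enum n).injective heq) hq
      · exact Or.inr hgt
    · rintro (hlt | hgt)
      · exact fun heq => absurd (heq ▸ hlt) (lt_irrefl _)
      · exact fun heq => absurd (heq ▸ hgt) (lt_irrefl _)
  have hdisj : Disjoint Dlt Dgt := by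
    rw [hDlt, hDgt, Finset.disjoint_filter]
    intro q _ hlt hgt
    exact lt_asymm hlt hgt
  have hlt : ∏ q ∈ Dlt, h q.1 q.2 = ∏ p : OD n, h p.1.1 p.1.2 :=
    Finset.prod_subtype Dlt (fun q => by simp [hDlt]) fun q => h q.1 q.2
  have hgt : ∏ q ∈ Dgt, h q.1 q.2 = ∏ p : OD n, h p.1.2 p.1.1 := by
    have : ∏ q ∈ Dgt, h q.1 q.2 = ∏ q ∈ Dlt, h q.2 q.1 := by
      refine Finset.prod_equiv (Equiv.prodComm n n) (fun q => ?_) (fun q _ => rfl)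
      simp [hDlt, hDgt]
    rw [this]
    exact Finset.prod_subtype Dlt (fun q => by simp [hDlt]) fun q => h q.2 q.1
  rw [h1, hsplit, Finset.prod_union hdisj, hlt, hgt, ← Finset.prod_mul_distrib]

/-- An off-diagonal double product is invariant under a simultaneous permutation of the indices.
[cite: BrockerTomDieck1985, IV (3.2) p0161] -/
theorem prod_offDiag_comp_perm (h : n → n → α) (σ : Perm n) :
    ∏ i, ∏ j ∈ Finset.univ.erase i, h (σ i) (σ j) = ∏ i, ∏ j ∈ Finset.univ.erase i, h i j := by
  have inner : ∀ i, ∏ j ∈ Finset.univ.erase i, h (σ i) (σ j) = ∏ j ∈ Finset.univ.erase (σ i), h (σ i) j :=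
    fun i => Finset.prod_equiv σ (fun j => by simp [σ.injective.ne_iff]) (fun j _ => rfl)
  simp_rw [inner]
  exact Equiv.prod_comp σ (fun i => ∏ j ∈ Finset.univ.erase i, h i j)

end OffDiag

/-- **The Vandermonde square as an off-diagonal product**: `Π_{j≺k}(θ_j − θ_k)² = Π_i Π_{j≠i} |θ_i − θ_j|` (the
determinant factor `det(E − Ad_{G/T}(t⁻¹)) = Π_{μ≠ν}|t_μ − t_ν|` of (1.11) for `U(n)`, Lie-algebra form).
[cite: BrockerTomDieck1985, IV (1.11) p0153] -/
theorem prod_OD_sub_sq_eq_prod_offDiag (θ : n → ℝ) :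
    ∏ p : OD n, (θ p.1.1 - θ p.1.2) ^ 2 = ∏ i, ∏ j ∈ Finset.univ.erase i, |θ i - θ j| := by
  rw [prod_offDiag_eq_prod_OD]
  refine Finset.prod_congr rfl fun p _ => ?_
  rw [abs_sub_comm (θ p.1.2), abs_mul_abs_self, sq]

/-- **Weyl-group invariance of the Vandermonde square**: `Π_{j≺k}(θ_{σj} − θ_{σk})² = Π_{j≺k}(θ_j − θ_k)²`.
[cite: BrockerTomDieck1985, IV (3.2) p0161] -/
theorem prod_OD_sub_sq_comp_perm (θ : n → ℝ) (σ : Perm n) :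
    ∏ p : OD n, ((θ ∘ σ) p.1.1 - (θ ∘ σ) p.1.2) ^ 2 = ∏ p : OD n, (θ p.1.1 - θ p.1.2) ^ 2 := by
  rw [prod_OD_sub_sq_eq_prod_offDiag, prod_OD_sub_sq_eq_prod_offDiag]
  exact prod_offDiag_comp_perm (fun a b => |θ a - θ b|) σ

/-! ## §2 `Ad(U(n))` in flat coordinates: a measure-preserving linear action -/

/-- `toMat (Ad(u) v) = u · toMat v · u*`. [cite: BrockerTomDieck1985, IV (1.8) p0152] -/
theorem toMat_AdCoord (u : Matrix n n ℂ) (v : Coord n) : toMat (AdCoord u v) = u * toMat v * star u := by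
  rw [AdCoord_apply, toMat_fromMat]
  rw [star_mul, star_mul, star_star, star_toMat]
  noncomm_ring

/-- `Ad(uw) = Ad(u) ∘ Ad(w)`. [cite: BrockerTomDieck1985, IV (1.8) p0152] -/
theorem AdCoord_mul (u w : Matrix n n ℂ) : AdCoord (u * w) = (AdCoord u).comp (AdCoord w) := by
  refine ContinuousLinearMap.ext fun v => toMat_injective ?_
  rw [ContinuousLinearMap.comp_apply, toMat_AdCoord, toMat_AdCoord, toMat_AdCoord, star_mul]
  noncomm_ring

/-- `Ad(u*) ∘ Ad(u) = id` for `u` unitary. [cite: BrockerTomDieck1985, IV (1.8) p0152] -/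
theorem AdCoord_star_comp_self {u : Matrix n n ℂ} (hu : u ∈ Matrix.unitaryGroup n ℂ) :
    (AdCoord (star u)).comp (AdCoord u) = ContinuousLinearMap.id ℝ (Coord n) := by
  rw [← AdCoord_mul, Matrix.mem_unitaryGroup_iff'.1 hu, AdCoord_one]

/-- `Ad(u) (Ad(u*) v) = v` and `Ad(u*) (Ad(u) v) = v`. [cite: BrockerTomDieck1985, IV (1.8) p0152] -/
theorem AdCoord_star_apply_AdCoord {u : Matrix n n ℂ} (hu : u ∈ Matrix.unitaryGroup n ℂ) (v : Coord n) :
    AdCoord (star u) (AdCoord u v) = v := by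
  have := congrArg (fun f : Coord n →L[ℝ] Coord n => f v) (AdCoord_star_comp_self hu)
  simpa using this

/-- `det Ad(u) ≠ 0` for `u` unitary. [cite: BrockerTomDieck1985, IV (1.8) p0152] -/
theorem det_AdCoord_ne_zero {u : Matrix n n ℂ} (hu : u ∈ Matrix.unitaryGroup n ℂ) : (AdCoord u).det ≠ 0 := by
  intro h0
  have hcomp : ∀ f g : Coord n →L[ℝ] Coord n, (f.comp g).det = f.det * g.det := fun f g =>
    LinearMap.det_comp (f : Coord n →ₗ[ℝ] Coord n) (g : Coord n →ₗ[ℝ] Coord n)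
  have hid : (ContinuousLinearMap.id ℝ (Coord n)).det = 1 := LinearMap.det_id
  have h := congrArg ContinuousLinearMap.det (AdCoord_star_comp_self hu)
  rw [hcomp, hid, h0, mul_zero] at h
  exact zero_ne_one h

/-- Lebesgue measure `dz dθ` on the flat coordinates `Coord n = ℂ^{OD} × ℝⁿ` of `𝔲(n)` is an additive Haar measure
(Helgason's «Euclidean measure dX»; instance made visible for the product type). [cite: Helgason2000, Ch. I §5 Thm. 5.17 p0186] -/
instance isAddHaarMeasure_volume_coord : (volume : Measure (Coord n)).IsAddHaarMeasure :=
  Measure.prod.instIsAddHaarMeasure _ _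

/-- The `Ad`-invariant gauge set `{v : ‖toMat v‖ ≤ 1}` (unit ball of the operator norm).
[cite: Helgason2000, Ch. I §5 Thm. 5.17 p0186] -/
def normBall (n : Type*) [Fintype n] [DecidableEq n] : Set (Coord n) := {v | ‖toMat v‖ ≤ 1}

/-- `Ad(u)⁻¹(K) = K` for the gauge set `K`. [cite: Helgason2000, Ch. I §5 Thm. 5.17 p0186] -/
theorem AdCoord_preimage_normBall {u : Matrix n n ℂ} (hu : u ∈ Matrix.unitaryGroup n ℂ) :
    AdCoord u ⁻¹' normBall n = normBall n := by
  ext v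
  simp only [Set.mem_preimage, normBall, Set.mem_setOf_eq, toMat_AdCoord]
  rw [CStarRing.norm_mul_mem_unitary _ (Unitary.star_mem hu), CStarRing.norm_mem_unitary_mul _ hu]

/-- The gauge set has positive Lebesgue measure (it contains a ball). [cite: Helgason2000, Ch. I §5 Thm. 5.17 p0186] -/
theorem volume_normBall_ne_zero : volume (normBall n) ≠ 0 := by
  set c : ℝ := ‖(toMatL (n := n))‖ + 1 with hc
  have hc0 : 0 < c := by positivity
  have hsub : Metric.ball (0 : Coord n) (1 / c) ⊆ normBall n := by
    intro v hv
    rw [Metric.mem_ball, dist_zero_right] at hv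
    simp only [normBall, Set.mem_setOf_eq]
    calc ‖toMat v‖ = ‖toMatL v‖ := by rw [toMatL_apply]
      _ ≤ ‖(toMatL (n := n))‖ * ‖v‖ := ContinuousLinearMap.le_opNorm _ _
      _ ≤ c * (1 / c) := by gcongr; linarith
      _ = 1 := by field_simp
  exact fun h0 => (Metric.measure_ball_pos volume (0 : Coord n) (by positivity)).ne' (measure_mono_null hsub h0)

/-- The gauge set has finite Lebesgue measure (it is bounded). [cite: Helgason2000, Ch. I §5 Thm. 5.17 p0186] -/
theorem volume_normBall_lt_top : volume (normBall n) < ⊤ := by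
  set c : ℝ := ‖((toLie (n := n)).symm : (unitaryLogChart n).lie →L[ℝ] Coord n)‖
  have hsub : normBall n ⊆ Metric.closedBall (0 : Coord n) c := by
    intro v hv
    simp only [normBall, Set.mem_setOf_eq] at hv
    rw [Metric.mem_closedBall, dist_zero_right]
    calc ‖v‖ = ‖((toLie (n := n)).symm : (unitaryLogChart n).lie →L[ℝ] Coord n) (toLie v)‖ := by simp
      _ ≤ c * ‖toLie v‖ := ContinuousLinearMap.le_opNorm _ _
      _ = c * ‖toMat v‖ := by rw [← coe_toLie]; rfl
      _ ≤ c * 1 := by gcongr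
      _ = c := mul_one c
  exact lt_of_le_of_lt (measure_mono hsub) measure_closedBall_lt_top

/-- **`|det Ad(u)| = 1` for `u ∈ U(n)`** (the gauge set is `Ad(u)`-invariant of positive finite measure).
[cite: Helgason2000, Ch. I §5 Thm. 5.17 p0186] -/
theorem abs_det_AdCoord {u : Matrix n n ℂ} (hu : u ∈ Matrix.unitaryGroup n ℂ) : |(AdCoord u).det| = 1 := by
  have h := Measure.addHaar_preimage_linearMap (volume : Measure (Coord n)) (f := (AdCoord u : Coord n →ₗ[ℝ] Coord n))
    (det_AdCoord_ne_zero hu) (normBall n)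
  rw [ContinuousLinearMap.coe_coe, AdCoord_preimage_normBall hu] at h
  have h1 : ENNReal.ofReal |(LinearMap.det (AdCoord u : Coord n →ₗ[ℝ] Coord n))⁻¹| = 1 := by
    exact (ENNReal.mul_left_inj volume_normBall_ne_zero volume_normBall_lt_top.ne).1 (h.symm.trans (one_mul _).symm)
  rw [ENNReal.ofReal_eq_one, abs_inv, inv_eq_one] at h1
  exact h1

/-- **`Ad(u)` preserves Lebesgue measure on `𝔲(n)` (flat coordinates)** for `u ∈ U(n)`.
[cite: Helgason2000, Ch. I §5 Thm. 5.17 p0186] -/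
theorem measurePreserving_AdCoord {u : Matrix n n ℂ} (hu : u ∈ Matrix.unitaryGroup n ℂ) :
    MeasurePreserving (AdCoord u) (volume : Measure (Coord n)) volume := by
  refine ⟨(AdCoord u).continuous.measurable, ?_⟩
  have h := Measure.map_linearMap_addHaar_eq_smul_addHaar (μ := (volume : Measure (Coord n)))
    (f := (AdCoord u : Coord n →ₗ[ℝ] Coord n)) (det_AdCoord_ne_zero hu)
  rw [abs_inv, ← ContinuousLinearMap.det, abs_det_AdCoord hu, inv_one, ENNReal.ofReal_one, one_smul,
    ContinuousLinearMap.coe_coe] at h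
  exact h

/-- `(u, v) ↦ Ad(u) v` is jointly continuous. [cite: BrockerTomDieck1985, IV (1.8) p0152] -/
theorem continuous_AdCoord_uncurry : Continuous fun p : Matrix n n ℂ × Coord n => AdCoord p.1 p.2 := by
  have : (fun p : Matrix n n ℂ × Coord n => AdCoord p.1 p.2) =
      fun p => fromMatL (p.1 * toMatL p.2 * star p.1) := by
    funext p; rw [AdCoord_apply, fromMatL_apply, toMatL_apply]
  rw [this]
  exact fromMatL.continuous.comp ((continuous_fst.mul (toMatL.continuous.comp continuous_snd)).mul
    continuous_fst.star)

/-- `e^{X(z)} ∈ U(n)`. [cite: Helgason2000, Ch. I §5 Thm. 5.17 p0186] -/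
theorem exp_offMat_mem_unitaryGroup (z : OD n → ℂ) : exp (offMat z) ∈ Matrix.unitaryGroup n ℂ := by
  rw [Matrix.mem_unitaryGroup_iff, ← exp_neg_offMat, exp_mul_exp_neg_eq_one (𝕂 := ℂ)]

/-- **The orbit map is `Ad` of the exponential applied to the slice**: `orbitMap (z, θ) = Ad(e^{X(z)})(0, θ)`.
[cite: Helgason2000, Ch. I §5 Thm. 5.17 p0186] -/
theorem orbitMap_eq_AdCoord (x : Coord n) : orbitMap x = AdCoord (exp (offMat x.1)) ((0 : OD n → ℂ), x.2) := by
  rw [orbitMap, orbitMat, AdCoord_apply, toMat_zero_left, exp_neg_offMat]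

/-- `toMat (orbitMap (z, θ)) = e^{X(z)} · i diag θ · (e^{X(z)})*`. [cite: Helgason2000, Ch. I §5 Thm. 5.17 p0186] -/
theorem toMat_orbitMap (x : Coord n) : toMat (orbitMap x) = exp (offMat x.1) * diagI x.2 * star (exp (offMat x.1)) := by
  rw [orbitMap_eq_AdCoord, toMat_AdCoord, toMat_zero_left]

omit [Fintype n] in
/-- A matrix with vanishing off-diagonal entries is `diagonal` of its diagonal. [cite: BrockerTomDieck1985, IV (3.1) p0160] -/
theorem eq_diagonal_of_offDiag_eq_zero {V : Matrix n n ℂ} (hV : ∀ j k, j ≠ k → V j k = 0) :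
    V = diagonal fun j => V j j := by
  ext j k
  by_cases hjk : j = k
  · subst hjk; rw [diagonal_apply_eq]
  · rw [diagonal_apply_ne _ hjk, hV j k hjk]

/-- A diagonal unitary `t` fixes the slice: `t · i diag θ · t* = i diag θ`. [cite: BrockerTomDieck1985, IV (3.1) p0160] -/
theorem diagonal_conj_diagI {d : n → ℂ} (hd : diagonal d ∈ Matrix.unitaryGroup n ℂ) (θ : n → ℝ) :
    diagonal d * diagI θ * star (diagonal d) = diagI θ := by
  have h1 : ∀ j, d j * star (d j) = 1 := fun j => by
    have := congr_fun (congr_fun (Matrix.mem_unitaryGroup_iff.1 hd) j) j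
    simpa [Matrix.mul_apply, diagonal, Matrix.one_apply] using this
  rw [diagI, star_eq_conjTranspose, diagonal_conjTranspose, diagonal_mul_diagonal, diagonal_mul_diagonal]
  congr 1
  funext j
  rw [mul_right_comm]
  change d j * star (d j) * _ = _
  rw [h1 j, one_mul]

/-- **The Weyl group acts on the slice through `Ad`**: `(0, θ ∘ σ) = Ad(P*) (0, θ)` for the permutation matrix
`P = monomial σ 1 ∈ U(n)`. [cite: BrockerTomDieck1985, IV (3.2) p0161] -/
theorem slice_comp_perm_eq_AdCoord (θ : n → ℝ) (σ : Perm n) :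
    (((0 : OD n → ℂ), θ ∘ σ) : Coord n) = AdCoord (star (monomial σ (fun _ => (1 : ℂ)))) ((0 : OD n → ℂ), θ) := by
  apply toMat_injective
  set P := monomial σ (fun _ => (1 : ℂ))
  have hPu : P ∈ Matrix.unitaryGroup n ℂ := monomial_one_mem_unitaryGroup σ
  rw [toMat_AdCoord, toMat_zero_left, toMat_zero_left, star_star, diagI_eq_monomial_conj θ σ]
  calc diagI (θ ∘ σ) = (star P * P) * diagI (θ ∘ σ) * (star P * P) := by
        rw [Matrix.mem_unitaryGroup_iff'.1 hPu, Matrix.one_mul, Matrix.mul_one]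
    _ = star P * (P * diagI (θ ∘ σ) * star P) * P := by noncomm_ring

/-- An `Ad(U(n))`-invariant function on `𝔲(n)` is `S(n)`-invariant on the slice. [cite: BrockerTomDieck1985, IV (3.2) p0161] -/
theorem slice_comp_perm_invariant {β : Type*} {Φ : Coord n → β}
    (hΦ : ∀ u ∈ Matrix.unitaryGroup n ℂ, ∀ x, Φ (AdCoord u x) = Φ x) (σ : Perm n) (θ : n → ℝ) :
    Φ ((0 : OD n → ℂ), θ ∘ σ) = Φ ((0 : OD n → ℂ), θ) := by
  rw [slice_comp_perm_eq_AdCoord]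
  exact hΦ _ (Unitary.star_mem (monomial_one_mem_unitaryGroup σ)) _

/-! ## §3 Injectivity of the orbit map on `{‖z‖ < r} × C` -/

/-- `|det N(z)| = |det D(orbitMap)(z, θ₀)| / Π_{j≺k}(θ₀_j − θ₀_k)²` — so `z ↦ |det N(z)|` is continuous.
[cite: Helgason2000, Ch. I §5 Thm. 5.17 (22) p0186] -/
theorem abs_det_Nmap_eq (z : OD n → ℂ) :
    |(Nmap z).det| = |(orbitDeriv (z, thetaStd n)).det| / ∏ p : OD n, (thetaStd n p.1.1 - thetaStd n p.1.2) ^ 2 := by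
  have hpos := prod_sub_sq_pos_of_mem_chamber (thetaStd_mem_chamber (n := n))
  rw [det_orbitDeriv, abs_mul, abs_mul, abs_det_AdCoord (exp_offMat_mem_unitaryGroup z), one_mul,
    abs_of_pos hpos, mul_div_cancel_right₀ _ hpos.ne']

/-- `z ↦ |det N(z)|` is continuous. [cite: Helgason2000, Ch. I §5 Thm. 5.17 (22) p0186] -/
theorem continuous_abs_det_Nmap : Continuous fun z : OD n → ℂ => |(Nmap z).det| := by
  simp_rw [abs_det_Nmap_eq]
  exact ((continuous_abs.comp (continuous_det_orbitDeriv.comp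
    (continuous_id.prodMk continuous_const))).div_const _)

/-- `|det N(0)| = 1`. [cite: Helgason2000, Ch. I §5 Thm. 5.17 (22) p0186] -/
theorem abs_det_Nmap_zero : |(Nmap (0 : OD n → ℂ)).det| = 1 := by
  rw [Nmap_zero, ContinuousLinearMap.det, ContinuousLinearMap.coe_id, LinearMap.det_id, abs_one]

/-- **INJECTIVITY OF THE ORBIT MAP ON `{‖z‖ < r} × C`** for some `r > 0` (Helgason: «only the injectivity on
`K/M × 𝔞⁺` remains to be verified …»): if `e^{X₁} D_{θ₁} e^{−X₁} = e^{X₂} D_{θ₂} e^{−X₂}` then `θ₁ = θ₂` and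
`e^{−X₂}e^{X₁} ∈ T` (file 3), so `e^{X₁} D_{θ₀} e^{−X₁} = e^{X₂} D_{θ₀} e^{−X₂}` at the base point `θ₀`, where the orbit
map is a local diffeomorphism (inverse function theorem, `det ≠ 0` by file 2). [cite: Helgason2000, Ch. I §5 Thm. 5.17 p0186] -/
theorem exists_injOn_orbitMap :
    ∃ r > 0, Set.InjOn (orbitMap (n := n)) (Metric.ball (0 : OD n → ℂ) r ×ˢ chamber n) := by
  set a : Coord n := ((0 : OD n → ℂ), thetaStd n) with ha
  have hdet : (orbitDeriv a).det ≠ 0 := by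
    rw [ha, det_orbitDeriv_zero]; exact (prod_sub_sq_pos_of_mem_chamber thetaStd_mem_chamber).ne'
  have hderiv : HasFDerivAt (orbitMap (n := n))
      (((orbitDeriv a).toContinuousLinearEquivOfDetNeZero hdet : Coord n ≃L[ℝ] Coord n) : Coord n →L[ℝ] Coord n) a := by
    rw [ContinuousLinearMap.coe_toContinuousLinearEquivOfDetNeZero]; exact hasFDerivAt_orbitMap a
  set Φ := (contDiff_orbitMap (n := n) (m := 1)).contDiffAt.toOpenPartialHomeomorph orbitMap hderiv one_ne_zero
    with hΦ
  have hsrc : a ∈ Φ.source := (contDiff_orbitMap (n := n) (m := 1)).contDiffAt.mem_toOpenPartialHomeomorph_source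
    hderiv one_ne_zero
  obtain ⟨r, hr, hball⟩ := Metric.isOpen_iff.1 Φ.open_source a hsrc
  have hmem : ∀ z : OD n → ℂ, z ∈ Metric.ball (0 : OD n → ℂ) r → ((z, thetaStd n) : Coord n) ∈ Φ.source := by
    intro z hz
    apply hball
    rw [Metric.mem_ball, Prod.dist_eq, ha, dist_self, max_eq_left dist_nonneg]
    exact Metric.mem_ball.1 hz
  refine ⟨r, hr, ?_⟩
  rintro ⟨z₁, θ₁⟩ ⟨hz₁, hθ₁⟩ ⟨z₂, θ₂⟩ ⟨hz₂, hθ₂⟩ heq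
  set e₁ := exp (offMat z₁) with he₁
  set e₂ := exp (offMat z₂) with he₂
  have hu₁ : e₁ ∈ Matrix.unitaryGroup n ℂ := exp_offMat_mem_unitaryGroup z₁
  have hu₂ : e₂ ∈ Matrix.unitaryGroup n ℂ := exp_offMat_mem_unitaryGroup z₂
  have hM : e₁ * diagI θ₁ * star e₁ = e₂ * diagI θ₂ * star e₂ := by
    have := congrArg toMat heq
    rwa [toMat_orbitMap, toMat_orbitMap] at this
  -- `V = e₂* e₁` conjugates `D_{θ₁}` to `D_{θ₂}`
  have hV : star e₂ * e₁ ∈ Matrix.unitaryGroup n ℂ := Submonoid.mul_mem _ (Unitary.star_mem hu₂) hu₁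
  have hVD : star e₂ * e₁ * diagI θ₁ * star (star e₂ * e₁) = diagI θ₂ := by
    calc star e₂ * e₁ * diagI θ₁ * star (star e₂ * e₁) = star e₂ * (e₁ * diagI θ₁ * star e₁) * e₂ := by
          rw [star_mul, star_star]; noncomm_ring
      _ = star e₂ * (e₂ * diagI θ₂ * star e₂) * e₂ := by rw [hM]
      _ = (star e₂ * e₂) * diagI θ₂ * (star e₂ * e₂) := by noncomm_ring
      _ = diagI θ₂ := by rw [Matrix.mem_unitaryGroup_iff'.1 hu₂, Matrix.one_mul, Matrix.mul_one]
  obtain ⟨hθ, hdiag⟩ := conj_diagI_eq_diagI hV hθ₁ hθ₂ hVD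
  -- `V` is diagonal, hence commutes with `D_{θ₀}`
  have hVdiag := eq_diagonal_of_offDiag_eq_zero hdiag
  have hcomm : star e₂ * e₁ * diagI (thetaStd n) = diagI (thetaStd n) * (star e₂ * e₁) := by
    rw [hVdiag, diagI, diagonal_mul_diagonal, diagonal_mul_diagonal]
    congr 1; funext j; ring
  have hsame : orbitMap (z₁, thetaStd n) = orbitMap (z₂, thetaStd n) := by
    apply toMat_injective
    rw [toMat_orbitMap, toMat_orbitMap]
    calc e₁ * diagI (thetaStd n) * star e₁ = e₂ * (star e₂ * e₁ * diagI (thetaStd n)) * star e₁ := by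
          rw [show e₂ * (star e₂ * e₁ * diagI (thetaStd n)) * star e₁ =
            (e₂ * star e₂) * (e₁ * diagI (thetaStd n) * star e₁) by noncomm_ring,
            Matrix.mem_unitaryGroup_iff.1 hu₂, Matrix.one_mul]
      _ = e₂ * (diagI (thetaStd n) * (star e₂ * e₁)) * star e₁ := by rw [hcomm]
      _ = e₂ * diagI (thetaStd n) * star e₂ * (e₁ * star e₁) := by noncomm_ring
      _ = e₂ * diagI (thetaStd n) * star e₂ := by rw [Matrix.mem_unitaryGroup_iff.1 hu₁, Matrix.mul_one]
  have hinj := Φ.injOn (hmem z₁ hz₁) (hmem z₂ hz₂)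
    (by rw [hΦ, ContDiffAt.toOpenPartialHomeomorph_coe]; exact hsame)
  have hz : z₁ = z₂ := congrArg Prod.fst hinj
  exact Prod.ext hz hθ

end Literature.RepresentationTheory.CompactGroups.WeylIntegration
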